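import Literature.AlgebraicGeometry.AbelianSchemes.DualIsogenyMulN
import Literature.AlgebraicGeometry.AbelianSchemes.AbelianSchemeDualIsogenyComp
import Literature.AlgebraicGeometry.AbelianSchemes.AbelianSchemeDualIsogenyHom
import Literature.AlgebraicGeometry.AbelianSchemes.AbelianSchemeOverField
import Literature.AlgebraicGeometry.Motives.AbelianVarietyDegreeGrowth
import Literature.AlgebraicGeometry.Motives.AbelianVarietyKerRankProofs
import Literature.AlgebraicGeometry.Motives.AbelianVarietyTorsionCubeProofs
import Literature.AlgebraicGeometry.Motives.AbelianVarietyIsogenyProofs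
import Literature.AlgebraicGeometry.Motives.FaltingsAbelianIsogenyProofs
import Literature.NumberTheory.DiophantineGeometry.AVKernelHopf
import HarnessLib

/-!
# The dual of an isogeny is an isogeny; degree of the dual isogeny from a similitude equation
# ([MumfordAV1970] §15 Thm. 1; [MilneAV2008] I §9; [GortzWedhorn2023] Prop. 27.186 ∕ 27.190)

Layer `Literature/AlgebraicGeometry/AbelianSchemes`, namespace `Literature.AlgebraicGeometry.AbelianSchemes.AbelianSchemeOver`
(`.DualPair`); the two §1 lemmas are dot-notation extensions of `Literature.AlgebraicGeometry.Motives.AbelianVariety.IsIsogeny`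
declared with their absolute names.  Cell `hodgecm-mathlib`, programme P6 (MOD), organ **(H4-R2)** of A-p17 (g24)'s ST-0′
«dual-position kernel» package (row (H4) «rank of `Ker ψ^∨`», route (R2) «similitude equation + multiplicativity of kernel
ranks»).  TWO plumbing definitions with body (`homOfIsMonHom` — a homomorphism of `k`-group schemes between abelian
`k`-schemes read as a morphism of abelian varieties; `DualPair.dualHom` — the dual homomorphism `ψ^∨` so read) + theorems;
no `Prop`-valued definition, no instance, no notation, no `sorry`.

## Mathematics

Let `k` be a field, `A′`, `B` abelian `k`-schemes (= abelian varieties over `k`, ★ `toAbelianVariety`) with dual pairs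
`D′ = (Â′, 𝒫′)`, `D_B = (B̂, 𝒫_B)` satisfying the unit hypothesis `𝒫|_{A × ε} ≅ 𝒪` (★ `AbelianSchemeDualPair`), and
`ψ : A′ → B` a homomorphism with dual homomorphism `ψ^∨ : B̂ → Â′` (★ `dualIsogenyOver`, [MumfordAV1970] §15 Thm. 1 «`f̂`»).
The DEGREE of an isogeny `f` is the order of its kernel, `deg f = dim_k Γ(Ker f, 𝒪)` (★ `Hom.kerRank`); degrees multiply
under composition (★ `IsIsogeny.kerRank_comp`, [Milne1986AbelianVarieties] §8) and `deg [n] = n^{2 dim}` (★ `kerRank_zsmul_id_holds`,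
[GortzWedhorn2023] Prop. 27.186).

* §1 (generalise) the CHAIN DEGREE LAW for abelian varieties over any field: if `ψ ≫ φ ≫ χ = c • θ` with all four
  homomorphisms isogenies and `c ≠ 0`, then `deg ψ · deg φ · deg χ = |c|^{2 dim A} · deg θ`
  (`IsIsogeny.kerRank_mul_mul_eq_of_comp_comp_eq_zsmul`); two-term form `ψ ≫ χ = c • θ` and the quasi-inverse form
  `ψ ≫ g = [n] ⇒ deg ψ · deg g = n^{2 dim A}` (`IsIsogeny.kerRank_mul_eq_of_comp_eq_nsmul_id`).
* §2 plumbing `homOfIsMonHom ψ : A′ ⟶ B` in the category of abelian varieties over `k` (`_comp`, `_id`, `_mulN`: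
  `[n]_{A′} ↦ n • 𝟙`), and §3 `dualHom ψ D′ D_B : B̂ ⟶ Â′` with `dualHom_comp` (`(ψ ≫ χ)^∨ = χ^∨ ≫ ψ^∨`, ★ `dualIsogenyOver_comp`)
  and `dualHom_mulN` (`[n]^∨ = [n]`, ★ `dualIsogenyOver_mulN`).
* §4 (specialise) **`isIsogeny_dualHom` — THE DUAL OF AN ISOGENY IS AN ISOGENY** ([MilneAV2008] I §9 / [GortzWedhorn2023]
  Prop. 27.190): an isogeny `ψ` has a quasi-inverse `g` with `ψ ≫ g = [n]_{A′}`, `g ≫ ψ = [n]_B`, `n ≥ 1` (★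
  `IsIsogeny.exists_nsmul_inverse_holds`, [MumfordAV1970] §19 Remark p. 169); dualising, `g^∨ ≫ ψ^∨ = [n]_{Â′}` and
  `ψ^∨ ≫ g^∨ = [n]_{B̂}` are isogenies (★ `isIsogeny_zsmul_id_holds`), so `ψ^∨` is surjective and finite
  (★ `isIsogeny_of_isIsogeny_comp_of_isIsogeny_comp`); and the degree law
  `deg ψ^∨ · deg g^∨ = n^{2 dim B̂}` (`kerRank_dualHom_mul_kerRank_dualHom_eq`).
* §5 (specialise) **`kerRank_mul_mul_kerRank_dualHom_eq` — DEGREE OF THE DUAL ISOGENY FROM THE SIMILITUDE EQUATION**: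
  for homomorphisms `λ_{A′} : A′ → Â′`, `λ_B : B → B̂` which are isogenies (e.g. polarizations) and
  `ψ ≫ λ_B ≫ ψ^∨ = λ_{A′} ≫ [c]_{Â′}` (`c ≥ 1`; the shape of ★ `relFrobenius_comp_baseChangeHom_comp_dualIsogeny`
  «`F_A ≫ λ^{(q)} ≫ F_A^∨ = λ ≫ [q]`» and of ★ `polarizationDesc`), `deg ψ · deg λ_B · deg ψ^∨ = c^{2 dim A′} · deg λ_{A′}`;
  with `λ_{A′}`, `λ_B` of the same degree (e.g. both principal) `deg ψ · deg ψ^∨ = c^{2 dim A′}`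
  (`kerRank_mul_kerRank_dualHom_eq_pow_of_kerRank_eq`).

What is deliberately NOT here: the unconditional `deg ψ^∨ = deg ψ` ([MumfordAV1970] §15 Thm. 1 «`Ker f̂ = (Ker f)^D`», Cartier
duality of the kernels — route (R1), which needs descent of line bundles along the `Ker ψ`-torsor `ψ` for a NON-constant finite
flat `Ker ψ`); the equality `dim Â = dim A` for an abstract dual pair in positive characteristic (the tree has it at points of
characteristic zero, ★ `DualPairFibreDim`; §5 obtains it from the isogeny `λ_{A′}`, ★ `dim_eq_of_isIsogeny`).

HC_CM is proved only modulo the printed citations until rung 0 closes; this file changes no count.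

## References
* [MumfordAV1970] D. Mumford, *Abelian Varieties* (1970), §15 Thm. 1 (p. 143) (`f̂`, `deg f̂ = deg f`), §19 Remark p. 169
  (quasi-inverse `g ∘ f = n_X`).
* [MilneAV2008] J. S. Milne, *Abelian Varieties* (2008), I §9 «Conversely, if `f` is an isogeny with kernel `N`, then `f^∨`
  is an isogeny» (Thm. 9.1), I §8 (8.5).
* [GortzWedhorn2023] U. Görtz, T. Wedhorn, *Algebraic Geometry II* (2023), Prop. 27.186 (`deg [n] = n^{2g}`), Prop. 27.190,
  Cor. 27.177 (degrees of isogenies).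
* [Milne1986AbelianVarieties] J. S. Milne, *Abelian Varieties* (Cornell–Silverman 1986), §8 (p. 115: `deg(g ∘ f) = deg g · deg f`).
-/

noncomputable section

universe u

open CategoryTheory CategoryTheory.Limits AlgebraicGeometry MonoidalCategory CartesianMonoidalCategory
open scoped MonObj

namespace Literature.AlgebraicGeometry.AbelianSchemes

namespace AbelianSchemeOver

open Literature.AlgebraicGeometry.Motives Literature.AlgebraicGeometry.Motives.AbelianVariety

/-! ## §1 The chain degree law for isogenies of abelian varieties (any field) -/

section Chain

variable {K : Type u} [Field K] {A B B' A' : AbelianVariety K}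

/-- **`deg (ψ ≫ φ ≫ χ) = deg ψ · deg φ · deg χ`** for isogenies of abelian varieties (★ `IsIsogeny.kerRank_comp` twice).
[cite: Milne1986AbelianVarieties, §8 (p. 115)] -/
theorem _root_.Literature.AlgebraicGeometry.Motives.AbelianVariety.IsIsogeny.kerRank_comp_comp
    {ψ : A ⟶ B} {φ : B ⟶ B'} {χ : B' ⟶ A'} (hψ : IsIsogeny ψ) (hφ : IsIsogeny φ) (hχ : IsIsogeny χ) :
    Hom.kerRank (ψ ≫ φ ≫ χ) = Hom.kerRank ψ * Hom.kerRank φ * Hom.kerRank χ := by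
  rw [hψ.kerRank_comp (isIsogeny_comp hφ hχ), hφ.kerRank_comp hχ, mul_assoc]

/-- `c • θ` is an isogeny when `θ` is and `c ≠ 0` (`c • θ = [c] ≫ θ`, ★ `isIsogeny_zsmul_id_holds`).
[cite: GortzWedhorn2023, Prop. 27.186 (p. 887)] -/
theorem _root_.Literature.AlgebraicGeometry.Motives.AbelianVariety.IsIsogeny.zsmul
    {θ : A ⟶ A'} (hθ : IsIsogeny θ) {c : ℤ} (hc : c ≠ 0) : IsIsogeny (c • θ) := by
  have h : c • θ = (c • 𝟙 A) ≫ θ := by rw [Preadditive.zsmul_comp, Category.id_comp]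
  rw [h]
  exact isIsogeny_comp (isIsogeny_zsmul_id_holds A c hc) hθ

/-- **`deg (c • θ) = |c|^{2 dim A} · deg θ`** for an isogeny `θ : A → A′` and `c ≠ 0` (`c • θ = [c]_A ≫ θ`, ★
`kerRank_zsmul_id_holds` «`deg [c] = c^{2g}`», ★ `IsIsogeny.kerRank_comp`). [cite: GortzWedhorn2023, Prop. 27.186 (p. 887)] -/
theorem _root_.Literature.AlgebraicGeometry.Motives.AbelianVariety.IsIsogeny.kerRank_zsmul
    {θ : A ⟶ A'} (hθ : IsIsogeny θ) {c : ℤ} (hc : c ≠ 0) :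
    Hom.kerRank (c • θ) = c.natAbs ^ (2 * A.dim) * Hom.kerRank θ := by
  have h : c • θ = (c • 𝟙 A) ≫ θ := by rw [Preadditive.zsmul_comp, Category.id_comp]
  rw [h, (isIsogeny_zsmul_id_holds A c hc).kerRank_comp hθ, kerRank_zsmul_id_holds A c hc]

/-- **THE CHAIN DEGREE LAW**: if `ψ ≫ φ ≫ χ = c • θ` with `ψ, φ, χ, θ` isogenies of abelian varieties over a field and
`c ≠ 0`, then `deg ψ · deg φ · deg χ = |c|^{2 dim A} · deg θ`. [cite: Milne1986AbelianVarieties, §8 (p. 115)]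
[cite: GortzWedhorn2023, Prop. 27.186 (p. 887)] -/
theorem _root_.Literature.AlgebraicGeometry.Motives.AbelianVariety.IsIsogeny.kerRank_mul_mul_eq_of_comp_comp_eq_zsmul
    {ψ : A ⟶ B} {φ : B ⟶ B'} {χ : B' ⟶ A'} {θ : A ⟶ A'} (hψ : IsIsogeny ψ) (hφ : IsIsogeny φ) (hχ : IsIsogeny χ)
    (hθ : IsIsogeny θ) {c : ℤ} (hc : c ≠ 0) (h : ψ ≫ φ ≫ χ = c • θ) :
    Hom.kerRank ψ * Hom.kerRank φ * Hom.kerRank χ = c.natAbs ^ (2 * A.dim) * Hom.kerRank θ := by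
  rw [← hψ.kerRank_comp_comp hφ hχ, h, hθ.kerRank_zsmul hc]

/-- Two-term form: `ψ ≫ χ = c • θ` with `ψ, χ, θ` isogenies and `c ≠ 0` gives `deg ψ · deg χ = |c|^{2 dim A} · deg θ`.
[cite: Milne1986AbelianVarieties, §8 (p. 115)] [cite: GortzWedhorn2023, Prop. 27.186 (p. 887)] -/
theorem _root_.Literature.AlgebraicGeometry.Motives.AbelianVariety.IsIsogeny.kerRank_mul_eq_of_comp_eq_zsmul
    {ψ : A ⟶ B} {χ : B ⟶ A'} {θ : A ⟶ A'} (hψ : IsIsogeny ψ) (hχ : IsIsogeny χ) (hθ : IsIsogeny θ) {c : ℤ}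
    (hc : c ≠ 0) (h : ψ ≫ χ = c • θ) :
    Hom.kerRank ψ * Hom.kerRank χ = c.natAbs ^ (2 * A.dim) * Hom.kerRank θ := by
  rw [← hψ.kerRank_comp hχ, h, hθ.kerRank_zsmul hc]

/-- **Quasi-inverse form: `ψ ≫ g = [n]_A` (`n ≠ 0`) with `ψ, g` isogenies gives `deg ψ · deg g = n^{2 dim A}`.**
[cite: MumfordAV1970, §19 Remark p. 169] [cite: GortzWedhorn2023, Prop. 27.186 (p. 887)] -/
theorem _root_.Literature.AlgebraicGeometry.Motives.AbelianVariety.IsIsogeny.kerRank_mul_eq_of_comp_eq_nsmul_id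
    {ψ : A ⟶ B} {g : B ⟶ A} (hψ : IsIsogeny ψ) (hg : IsIsogeny g) {n : ℕ} (hn : n ≠ 0) (h : ψ ≫ g = n • 𝟙 A) :
    Hom.kerRank ψ * Hom.kerRank g = n ^ (2 * A.dim) := by
  have h' : ψ ≫ g = (n : ℤ) • 𝟙 A := by rw [h, natCast_zsmul]
  have := hψ.kerRank_mul_eq_of_comp_eq_zsmul hg (isIsogeny_id A) (Int.natCast_ne_zero.mpr hn) h'
  rwa [kerRank_id, mul_one, Int.natAbs_natCast] at this

end Chain

/-! ## §2 Homomorphisms of abelian `k`-schemes as morphisms of abelian varieties -/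

variable {k : Type u} [Field k] {A' B C : AbelianSchemeOver (Spec (.of k))}

/-- **A homomorphism of `k`-group schemes `ψ : A′ → B` between abelian `k`-schemes, read as a morphism of abelian varieties
`A′ ⟶ B`** (same `k`-group schemes: ★ `toAffine`, ★ `toAbelianVariety` are the identity on carriers; the category of
abelian varieties is induced from `Grp (Over (Spec k))`, Mathlib `Grp.homMk`). [cite: MumfordAV1970, §4 Cor. 1 (p. 43)] -/
def homOfIsMonHom (ψ : A'.X ⟶ B.X) [IsMonHom ψ] : A'.toAffine.toAbelianVariety ⟶ B.toAffine.toAbelianVariety :=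
  -- `Grp.ofHom ψ : Grp.mk A′.X ⟶ Grp.mk B.X` is elaborated with the group structures of `A′`, `B` themselves (`( · :)`);
  -- those of the abelian varieties `A′.toAffine.toAbelianVariety`, … are the same definitionally.
  InducedCategory.homMk (X := A'.toAffine.toAbelianVariety) (Y := B.toAffine.toAbelianVariety) (Grp.ofHom ψ :)

/-- Its underlying morphism of `k`-group schemes is `ψ` (definitional). [cite: MumfordAV1970, §4 Cor. 1 (p. 43)] -/
@[simp]
theorem homOfIsMonHom_hom (ψ : A'.X ⟶ B.X) [IsMonHom ψ] : (homOfIsMonHom ψ).hom.hom.hom = ψ := rfl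

/-- Its underlying morphism of schemes is `ψ.left` (definitional). [cite: MumfordAV1970, §4 Cor. 1 (p. 43)] -/
theorem toSchemeHom_homOfIsMonHom (ψ : A'.X ⟶ B.X) [IsMonHom ψ] : Hom.toSchemeHom (homOfIsMonHom ψ) = ψ.left := rfl

/-- `homOfIsMonHom` is compatible with composition. [cite: MumfordAV1970, §4 Cor. 1 (p. 43)] -/
theorem homOfIsMonHom_comp (ψ : A'.X ⟶ B.X) [IsMonHom ψ] (χ : B.X ⟶ C.X) [IsMonHom χ] :
    homOfIsMonHom (ψ ≫ χ) = homOfIsMonHom ψ ≫ homOfIsMonHom χ :=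
  AbelianVariety.hom_ext _ _ rfl

variable (A') in
/-- `homOfIsMonHom (𝟙 A′) = 𝟙`. [cite: MumfordAV1970, §4 Cor. 1 (p. 43)] -/
theorem homOfIsMonHom_id : homOfIsMonHom (𝟙 A'.X) = 𝟙 A'.toAffine.toAbelianVariety :=
  AbelianVariety.hom_ext _ _ rfl

variable (A') in
/-- **`[n]_{A′} = (𝟙)^n` read as a morphism of abelian varieties is `n • 𝟙`** (★ `mulN`, ★ `AbelianVariety.hom_zsmul_id`,
`zpow_natCast`) — the universe-polymorphic form of ★ `mulN_eq_hom_zsmul_one` (`GlobalOneFormsMulNOfAbelianSchemeOver`, stated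
there for `k : Type`). [cite: GortzWedhorn2023, (27.35.1)] -/
theorem mulN_eq_hom_zsmul_id (n : ℕ) : A'.mulN n = (((n : ℤ) • 𝟙 A'.toAffine.toAbelianVariety).hom.hom.hom) := by
  rw [AbelianVariety.hom_zsmul_id, zpow_natCast]
  rfl

variable (A') in
/-- `homOfIsMonHom [n]_{A′} = n • 𝟙` for any homomorphism structure on `[n]_{A′}` (over the reduced base `Spec k` the abelian
scheme is commutative and `[n]` is a homomorphism, ★ `isMonHom_mulN`). [cite: GortzWedhorn2023, (27.35.1)] -/
theorem homOfIsMonHom_mulN (n : ℕ) [IsMonHom (A'.mulN n)] :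
    homOfIsMonHom (A'.mulN n) = (n : ℤ) • 𝟙 A'.toAffine.toAbelianVariety :=
  AbelianVariety.hom_ext _ _ (A'.mulN_eq_hom_zsmul_id n)

/-! ## §3 The dual homomorphism as a morphism of abelian varieties -/

namespace DualPair

variable (ψ : A'.X ⟶ B.X) [IsMonHom ψ] (χ : B.X ⟶ C.X) [IsMonHom χ] (D' : A'.DualPair) (DB : B.DualPair) (DC : C.DualPair)
  (hD' : Nonempty ((Scheme.Modules.pullback (unitHatSlice D')).obj D'.P ≅ SheafOfModules.unit _))
  (hDB : Nonempty ((Scheme.Modules.pullback (unitHatSlice DB)).obj DB.P ≅ SheafOfModules.unit _))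
  (hDC : Nonempty ((Scheme.Modules.pullback (unitHatSlice DC)).obj DC.P ≅ SheafOfModules.unit _))

/-- **The dual homomorphism `ψ^∨ : B̂ ⟶ Â′` as a morphism of abelian varieties over `k`** (★ `dualIsogenyOver`, a
homomorphism over the reduced base `Spec k` by ★ `isMonHom_dualIsogenyOver` under the unit hypotheses).
[cite: MumfordAV1970, §15 Thm. 1 (p. 143)] [cite: MilneAV2008, I §9 Thm. 9.1 (p. 42)] -/
def dualHom : DB.hat.toAffine.toAbelianVariety ⟶ D'.hat.toAffine.toAbelianVariety :=
  haveI := isMonHom_dualIsogenyOver ψ D' DB hDB hD'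
  homOfIsMonHom (dualIsogenyOver ψ D' DB)

/-- Its underlying morphism of `k`-group schemes is `dualIsogenyOver ψ D′ D_B` (definitional).
[cite: MumfordAV1970, §15 Thm. 1 (p. 143)] -/
@[simp]
theorem dualHom_hom : (dualHom ψ D' DB hD' hDB).hom.hom.hom = dualIsogenyOver ψ D' DB := rfl

/-- Its underlying morphism of schemes is `dualIsogeny ψ D′ D_B : B̂ → Â′` (definitional). [cite: MumfordAV1970, §15 Thm. 1 (p. 143)] -/
theorem toSchemeHom_dualHom : Hom.toSchemeHom (dualHom ψ D' DB hD' hDB) = dualIsogeny ψ D' DB := rfl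

/-- `dualHom` depends only on the homomorphism, not on the `IsMonHom` witness. [cite: MilneAV2008, I §9 Thm. 9.1 (p. 42)] -/
theorem dualHom_congr {ψ₁ ψ₂ : A'.X ⟶ B.X} {h₁ : IsMonHom ψ₁} [h₂ : IsMonHom ψ₂] (h : ψ₁ = ψ₂) :
    @dualHom k _ A' B ψ₁ h₁ D' DB hD' hDB = @dualHom k _ A' B ψ₂ h₂ D' DB hD' hDB := by
  subst h
  rfl

/-- **`(ψ ≫ χ)^∨ = χ^∨ ≫ ψ^∨`** as morphisms of abelian varieties (★ `dualIsogenyOver_comp`).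
[cite: MilneAV2008, I §9 (p. 42)] [cite: MumfordAV1970, §15 Thm. 1 (p. 143)] -/
theorem dualHom_comp :
    dualHom (ψ ≫ χ) D' DC hD' hDC = dualHom χ DB DC hDB hDC ≫ dualHom ψ D' DB hD' hDB :=
  AbelianVariety.hom_ext _ _ (by
    rw [AbelianVariety.comp_hom]
    exact dualIsogenyOver_comp ψ χ D' DB DC)

/-- **`[n]^∨ = [n]`**: the dual of `[n]_{A′}` (for any homomorphism structure on it) is `n • 𝟙_{Â′}` as a morphism of abelian
varieties (★ `dualIsogenyOver_mulN`, [MumfordAV1970] §15 proof of Thm. 1 «`(n_X)^ = n_{X̂}`»). [cite: MumfordAV1970, §15 Thm. 1 (p. 143)] -/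
theorem dualHom_mulN (n : ℕ) [IsMonHom (A'.mulN n)] :
    dualHom (A'.mulN n) D' D' hD' hD' = (n : ℤ) • 𝟙 D'.hat.toAffine.toAbelianVariety := by
  refine AbelianVariety.hom_ext _ _ ?_
  -- the two `IsMonHom` witnesses on `[n]_{A′}` agree by proof irrelevance, so `rw` closes the goal
  rw [dualHom_hom, ← D'.hat.mulN_eq_hom_zsmul_id n, ← D'.dualIsogenyOver_mulN hD' n]

/-! ## §4 The dual of an isogeny is an isogeny -/

/-- **THE DUAL OF AN ISOGENY IS AN ISOGENY.** If `ψ : A′ → B` is an isogeny of abelian varieties over a field `k`, then so is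
`ψ^∨ : B̂ → Â′`: a quasi-inverse `g` with `ψ ≫ g = [n]_{A′}`, `g ≫ ψ = [n]_B`, `n ≥ 1` (★ `IsIsogeny.exists_nsmul_inverse_holds`)
dualises to `g^∨ ≫ ψ^∨ = [n]_{Â′}`, `ψ^∨ ≫ g^∨ = [n]_{B̂}` (§3), both isogenies (★ `isIsogeny_zsmul_id_holds`), whence `ψ^∨`
is an isogeny (★ `isIsogeny_of_isIsogeny_comp_of_isIsogeny_comp`). [cite: MilneAV2008, I §9 Thm. 9.1 (p. 42)]
[cite: MumfordAV1970, §15 Thm. 1 (p. 143)] [cite: GortzWedhorn2023, Prop. 27.190] -/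
theorem isIsogeny_dualHom (hψ : IsIsogeny (homOfIsMonHom ψ)) : IsIsogeny (dualHom ψ D' DB hD' hDB) := by
  obtain ⟨g, n, hn, h1, h2⟩ := IsIsogeny.exists_nsmul_inverse_holds hψ
  haveI : IsCommMonObj A'.X := A'.isCommMonObj_of_isReduced_base
  haveI : IsCommMonObj B.X := B.isCommMonObj_of_isReduced_base
  haveI := A'.isMonHom_mulN n
  haveI := B.isMonHom_mulN n
  -- the underlying homomorphism `g₀ : B → A′` of the quasi-inverse
  let g₀ : B.X ⟶ A'.X := g.hom.hom.hom
  haveI hg₀ : IsMonHom g₀ := g.hom.hom.isMonHom_hom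
  -- `ψ ≫ g₀ = [n]_{A′}` and `g₀ ≫ ψ = [n]_B`
  have h1' : ψ ≫ g₀ = A'.mulN n := by
    rw [mulN_eq_hom_zsmul_id, natCast_zsmul]
    exact congrArg (fun f => f.hom.hom.hom) h1
  have h2' : g₀ ≫ ψ = B.mulN n := by
    rw [mulN_eq_hom_zsmul_id, natCast_zsmul]
    exact congrArg (fun f => f.hom.hom.hom) h2
  -- dualise: `g₀^∨ ≫ ψ^∨ = [n]_{Â′}`, `ψ^∨ ≫ g₀^∨ = [n]_{B̂}`
  have hd1 : dualHom g₀ DB D' hDB hD' ≫ dualHom ψ D' DB hD' hDB = (n : ℤ) • 𝟙 D'.hat.toAffine.toAbelianVariety := by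
    rw [← dualHom_comp, dualHom_congr D' D' hD' hD' h1', dualHom_mulN]
  have hd2 : dualHom ψ D' DB hD' hDB ≫ dualHom g₀ DB D' hDB hD' = (n : ℤ) • 𝟙 DB.hat.toAffine.toAbelianVariety := by
    rw [← dualHom_comp, dualHom_congr DB DB hDB hDB h2', dualHom_mulN]
  have hnz : (n : ℤ) ≠ 0 := Int.natCast_ne_zero.mpr hn.ne'
  refine isIsogeny_of_isIsogeny_comp_of_isIsogeny_comp (g₁ := dualHom g₀ DB D' hDB hD') (g₂ := dualHom g₀ DB D' hDB hD')
    ?_ ?_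
  · rw [hd2]; exact isIsogeny_zsmul_id_holds _ _ hnz
  · rw [hd1]; exact isIsogeny_zsmul_id_holds _ _ hnz

/-- **`deg ψ^∨ · deg g^∨ = n^{2 dim B̂}` for a quasi-inverse pair `ψ ≫ g = [n]_{A′}`, `g ≫ ψ = [n]_B`** (`n ≠ 0`; the
isogenies `ψ^∨`, `g^∨` compose to `[n]_{B̂}`; §1 `IsIsogeny.kerRank_mul_eq_of_comp_eq_nsmul_id`). Together with
`deg ψ · deg g = n^{2 dim A′}` this is the degree bookkeeping of [MumfordAV1970] §15 Thm. 1 short of `deg ψ^∨ = deg ψ`.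
[cite: MumfordAV1970, §15 Thm. 1 (p. 143)] [cite: GortzWedhorn2023, Prop. 27.186 (p. 887)] -/
theorem kerRank_dualHom_mul_kerRank_dualHom_eq (hψ : IsIsogeny (homOfIsMonHom ψ)) (g : B.X ⟶ A'.X) [IsMonHom g]
    (hg : IsIsogeny (homOfIsMonHom g)) {n : ℕ} (hn : n ≠ 0) (h : g ≫ ψ = B.mulN n) :
    Hom.kerRank (dualHom ψ D' DB hD' hDB) * Hom.kerRank (dualHom g DB D' hDB hD') =
      n ^ (2 * DB.hat.toAffine.toAbelianVariety.dim) := by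
  haveI : IsCommMonObj B.X := B.isCommMonObj_of_isReduced_base
  haveI := B.isMonHom_mulN n
  refine (isIsogeny_dualHom ψ D' DB hD' hDB hψ).kerRank_mul_eq_of_comp_eq_nsmul_id
    (isIsogeny_dualHom g DB D' hDB hD' hg) hn ?_
  rw [← dualHom_comp, dualHom_congr DB DB hDB hDB h, dualHom_mulN, natCast_zsmul]

/-! ## §5 Degree of the dual isogeny from the similitude equation -/

/-- **DEGREE OF THE DUAL ISOGENY FROM THE SIMILITUDE EQUATION.** Let `ψ : A′ → B` be an isogeny, `λ_{A′} : A′ → Â′` and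
`λ_B : B → B̂` homomorphisms which are isogenies (e.g. polarizations), and `c ≥ 1` with the similitude equation
`ψ ≫ λ_B ≫ ψ^∨ = λ_{A′} ≫ [c]_{Â′}` (in `Over (Spec k)`). Then `deg ψ · deg λ_B · deg ψ^∨ = c^{2 dim A′} · deg λ_{A′}`
(§4 `ψ^∨` is an isogeny; §1 chain degree law; `[c]` commutes past the homomorphism `λ_{A′}`).
[cite: MumfordAV1970, §15 Thm. 1 (p. 143); §23] [cite: GortzWedhorn2023, Prop. 27.186 (p. 887)] -/
theorem kerRank_mul_mul_kerRank_dualHom_eq (hψ : IsIsogeny (homOfIsMonHom ψ))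
    (lamA : A'.X ⟶ D'.hat.X) [IsMonHom lamA] (lamB : B.X ⟶ DB.hat.X) [IsMonHom lamB]
    (hlamA : IsIsogeny (homOfIsMonHom lamA)) (hlamB : IsIsogeny (homOfIsMonHom lamB)) {c : ℕ} (hc : c ≠ 0)
    (h : ψ ≫ lamB ≫ dualIsogenyOver ψ D' DB = lamA ≫ D'.hat.mulN c) :
    Hom.kerRank (homOfIsMonHom ψ) * Hom.kerRank (homOfIsMonHom lamB) * Hom.kerRank (dualHom ψ D' DB hD' hDB) =
      c ^ (2 * A'.toAffine.toAbelianVariety.dim) * Hom.kerRank (homOfIsMonHom lamA) := by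
  haveI : IsCommMonObj D'.hat.X := D'.hat.isCommMonObj_of_isReduced_base
  haveI := D'.hat.isMonHom_mulN c
  have hc' : (c : ℤ) ≠ 0 := Int.natCast_ne_zero.mpr hc
  -- the similitude equation as morphisms of abelian varieties: `ψ ≫ λ_B ≫ ψ^∨ = c • λ_{A′}`
  have h' : homOfIsMonHom ψ ≫ homOfIsMonHom lamB ≫ dualHom ψ D' DB hD' hDB = (c : ℤ) • homOfIsMonHom lamA := by
    have hR : (c : ℤ) • homOfIsMonHom lamA = homOfIsMonHom lamA ≫ ((c : ℤ) • 𝟙 _) := by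
      rw [Preadditive.comp_zsmul, Category.comp_id]
    rw [hR, ← homOfIsMonHom_mulN, ← homOfIsMonHom_comp]
    exact AbelianVariety.hom_ext _ _ h
  have := hψ.kerRank_mul_mul_eq_of_comp_comp_eq_zsmul hlamB (isIsogeny_dualHom ψ D' DB hD' hDB hψ) hlamA hc' h'
  rwa [Int.natAbs_natCast] at this

/-- **Same, with `λ_{A′}` and `λ_B` of the same degree** (e.g. both principal polarizations, degree `1`):
`deg ψ · deg ψ^∨ = c^{2 dim A′}`, i.e. `rk Ker ψ^∨ = c^{2 dim A′} ∕ rk Ker ψ` — row (H4) of the ST-0′ package in route (R2).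
[cite: MumfordAV1970, §15 Thm. 1 (p. 143); §23] [cite: GortzWedhorn2023, Prop. 27.186 (p. 887)] -/
theorem kerRank_mul_kerRank_dualHom_eq_pow_of_kerRank_eq (hψ : IsIsogeny (homOfIsMonHom ψ))
    (lamA : A'.X ⟶ D'.hat.X) [IsMonHom lamA] (lamB : B.X ⟶ DB.hat.X) [IsMonHom lamB]
    (hlamA : IsIsogeny (homOfIsMonHom lamA)) (hlamB : IsIsogeny (homOfIsMonHom lamB))
    (hdeg : Hom.kerRank (homOfIsMonHom lamA) = Hom.kerRank (homOfIsMonHom lamB)) {c : ℕ} (hc : c ≠ 0)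
    (h : ψ ≫ lamB ≫ dualIsogenyOver ψ D' DB = lamA ≫ D'.hat.mulN c) :
    Hom.kerRank (homOfIsMonHom ψ) * Hom.kerRank (dualHom ψ D' DB hD' hDB) = c ^ (2 * A'.toAffine.toAbelianVariety.dim) := by
  have hmain := kerRank_mul_mul_kerRank_dualHom_eq ψ D' DB hD' hDB hψ lamA lamB hlamA hlamB hc h
  have hpos : 0 < Hom.kerRank (homOfIsMonHom lamB) := by
    haveI := hlamB.2
    exact Hom.kerRank_pos _
  rw [hdeg, mul_right_comm] at hmain
  exact Nat.eq_of_mul_eq_mul_right hpos hmain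

/-- **Principal case**: if `λ_{A′}` and `λ_B` are isomorphisms of `k`-group schemes (principal polarizations) and
`ψ ≫ λ_B ≫ ψ^∨ = λ_{A′} ≫ [c]_{Â′}`, then `deg ψ · deg ψ^∨ = c^{2 dim A′}`. [cite: MumfordAV1970, §15 Thm. 1 (p. 143); §23]
[cite: GortzWedhorn2023, Prop. 27.186 (p. 887)] -/
theorem kerRank_mul_kerRank_dualHom_eq_pow_of_isIso (hψ : IsIsogeny (homOfIsMonHom ψ))
    (lamA : A'.X ⟶ D'.hat.X) [IsMonHom lamA] [IsIso lamA] (lamB : B.X ⟶ DB.hat.X) [IsMonHom lamB] [IsIso lamB]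
    {c : ℕ} (hc : c ≠ 0) (h : ψ ≫ lamB ≫ dualIsogenyOver ψ D' DB = lamA ≫ D'.hat.mulN c) :
    Hom.kerRank (homOfIsMonHom ψ) * Hom.kerRank (dualHom ψ D' DB hD' hDB) = c ^ (2 * A'.toAffine.toAbelianVariety.dim) := by
  -- an isomorphism of group schemes is an isogeny of degree `1`
  have hiso : ∀ {P Q : AbelianSchemeOver (Spec (.of k))} (e : P.X ⟶ Q.X) [IsMonHom e] [IsIso e],
      IsIsogeny (homOfIsMonHom e) ∧ Hom.kerRank (homOfIsMonHom e) = 1 := by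
    intro P Q e _ _
    haveI : IsIso (Hom.toSchemeHom (homOfIsMonHom e)) := inferInstanceAs (IsIso ((Over.forget _).map e))
    have hI : IsIsogeny (homOfIsMonHom e) := ⟨inferInstance, inferInstance⟩
    refine ⟨hI, ?_⟩
    rw [← hI.finrank_eq_kerRank (genericPoint Q.toAffine.toAbelianVariety.X.left)]
    exact congrFun (Scheme.Hom.finrank_eq_one_of_isIso (Hom.toSchemeHom (homOfIsMonHom e))) _
  obtain ⟨hA, hA1⟩ := hiso lamA
  obtain ⟨hB, hB1⟩ := hiso lamB
  exact kerRank_mul_kerRank_dualHom_eq_pow_of_kerRank_eq ψ D' DB hD' hDB hψ lamA lamB hA hB (hA1.trans hB1.symm) hc h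

end DualPair

end AbelianSchemeOver

end Literature.AlgebraicGeometry.AbelianSchemes

end
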